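import Literature.AlgebraicGeometry.Frobenioids.BirationalizationPreModel
import Literature.AlgebraicGeometry.Frobenioids.PreFrobenioidPullbacks
import HarnessLib

/-!
# Frobenioids I, Proposition 4.4 (ii) ["`C^birat` is a Frobenioid"]: the clauses Def. 1.3 (i), (ii),
# (iv) — pull-back morphisms, Frobenius type, factorisation — PROVED for THE birationalization of a
# Frobenioid of isotropic type

Mochizuki, *The geometry of Frobenioids I: the general theory*, Kyushu J. Math. **62** (2008)
293–400, §4, Proposition 4.4 (ii), kurims text p. 83 [cite: MochizukiFrdI2008, Prop. 4.4 (ii) p.83]: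
"(ii) `C^birat` is equipped with a natural structure of Frobenioid"; the author's *Comments* (2024)
(29) restrict this assertion to Frobenioids of birationally Frobenius-normalized type. The present file
is independent of that correction: for `C` a Frobenioid of ISOTROPIC type (no normalization hypothesis)
it proves those clauses of Def. 1.3 [cite: MochizukiFrdI2008, Def. 1.3 p.24] for the pre-Frobenioid
structure `Birat.toElemZero hF hsq : C^birat ⥤ F_{0_D}` (seat abc-iut-L6-t8) that concern pull-back
morphisms, morphisms of Frobenius type and the factorisation of morphisms:

* `PreFrobenioid.Birat.i_a`, `i_b`, `i_c` — Def. 1.3 (i): Frobenius-trivial objects over every base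
  (images, `BirationalizationPreModel.lean`), base-isomorphisms realised by pairs of pre-steps (images
  of those of `C`), and `(C^birat)^pl-bk_A → D_{A_D}` an equivalence (faithful and full formally,
  `PreFrobenioidPullbacks.lean`; essentially surjective because the image of a pull-back morphism of
  `C` is a pull-back morphism of `C^birat`, Prop. 4.4 (iv), seat abc-iut-L6-t8's
  `isPullbackMorphism_toBirat_map`);
* `PreFrobenioid.Birat.ii_exists`, `ii_unique` — Def. 1.3 (ii): existence (images) and essential
  uniqueness of morphisms of Frobenius type of prescribed degree (common denominator, factorisation
  "Frobenius type, then a pre-step" in `C`, Def. 1.3 (ii) of `C`; pre-steps of `C^birat` are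
  invertible, Prop. 4.8 (i));
* `PreFrobenioid.Birat.iv_a_exists`, `iv_a_unique`, `iv_b` — Def. 1.3 (iv): `[(α, φ′)]` factors as
  `(α⁻¹ γ β) , id , a` for the factorisation `φ′ = γ β a` of `C`, uniquely up to the printed
  isomorphisms (pull-back property of `a`), and pull-back morphisms of `C^birat` are LB-invertible and
  linear.

Each theorem's type is literally the body of the corresponding field of `PreFrobenioid.IsFrobenioid`
at `F := Birat.toElemZero hF hsq`, so that the assembly of "`C^birat` is a Frobenioid" (row W14 of the
abc-iut cell, seat abc-iut-w5-d227: the clauses (iii), (v)–(vii) and the pre-Frobenioid conditions)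
reads `i_b := Birat.i_b`, … . Inputs by name: the fraction calculus of
`DivisorMonoidBirationalTypesProofs.lean` / `DivisorMonoidBirationalPerfectProofs.lean` (seat
abc-iut-L6-t20: in `C^birat` of an isotropic Frobenioid every pre-step is an isomorphism, every
morphism is co-angular, Frobenius type = base-isomorphism). PROOF-ONLY file (theorems only). No
statement of the paper is strengthened; nothing here concerns the disputed parts of IUT.
-/

namespace Literature.AlgebraicGeometry.Frobenioids

open CategoryTheory Opposite

universe w v v' u u'

namespace PreFrobenioid

variable {D : Type u} [Category.{v} D] {Φ : Dᵒᵖ ⥤ CommMonCat.{w}}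
  {C : Type u'} [Category.{v'} C] {F : C ⥤ ElemFrobenioid Φ}
  {hF : IsFrobenioid F} {hsq : HasBiratSquares F}

namespace Birat

/-! ### Refining a fraction -/

/-- Refining a fraction `(α, φ′)` by `κ`: `(κ ≫ α)^birat ≫ [(α, φ′)] = (κ ≫ φ′)^birat`.
[cite: MochizukiFrdI2008, Prop. 4.4 (i) p.83] -/
theorem toBirat_map_comp_den_comp_homMk {A B : C} (f : BiratFrac F A B) {E : C} (κ : E ⟶ f.src) :
    (toBirat F hF hsq).map (κ ≫ f.den) ≫
        (homMk f : (toBirat F hF hsq).obj A ⟶ (toBirat F hF hsq).obj B) =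
      (toBirat F hF hsq).map (κ ≫ f.num) := by
  rw [Functor.map_comp, Category.assoc, toBirat_map_den_comp_homMk hF hsq f, ← Functor.map_comp]

/-! ### Def. 1.3 (i) -/

/-- **Def. 1.3 (i)(a) for `C^birat`** (`C` of isotropic type): every object of `D` is isomorphic to the
base of a Frobenius-trivial object — the image of the one supplied by Def. 1.3 (i)(a) of `C`
(`BirationalizationPreModel.lean`: images of Frobenius-trivial objects are Frobenius-trivial).
[cite: MochizukiFrdI2008, Prop. 4.4 (ii) p.83] -/
theorem i_a (hiso : IsOfIsotropicType F) (A₀ : D) :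
    ∃ X : Birat F hF hsq, IsFrobeniusTrivial (toElemZero hF hsq) X ∧
      Nonempty (baseObj (toElemZero hF hsq) X ≅ A₀) := by
  obtain ⟨A, hA, ⟨e⟩⟩ := hF.i_a A₀
  exact ⟨(toBirat F hF hsq).obj A, isFrobeniusTrivial hiso hA, ⟨e⟩⟩

/-- **Def. 1.3 (i)(b) for `C^birat`**: every base-isomorphism `A_D ⥲ B_D` is `Base(ψ) ∘ Base(φ)⁻¹`
for pre-steps `φ : X → A^birat`, `ψ : X → B^birat` — the images of the pre-steps supplied by
Def. 1.3 (i)(b) of `C` (Prop. 4.4 (iv): pre-step ↦ pre-step). [cite: MochizukiFrdI2008, Prop. 4.4 (ii) p.83] -/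
theorem i_b (X Y : Birat F hF hsq)
    (α : baseObj (toElemZero hF hsq) X ≅ baseObj (toElemZero hF hsq) Y) :
    ∃ (W : Birat F hF hsq) (φ : W ⟶ X) (ψ : W ⟶ Y), IsPreStep (toElemZero hF hsq) φ ∧
      IsPreStep (toElemZero hF hsq) ψ ∧
      Base (toElemZero hF hsq) φ ≫ α.hom = Base (toElemZero hF hsq) ψ := by
  obtain ⟨W, φ, ψ, hφ, hψ, h⟩ := hF.i_b X.out Y.out α
  have key : Base (toElemZero hF hsq) ((toBirat F hF hsq).map φ) ≫ α.hom =
      Base (toElemZero hF hsq) ((toBirat F hF hsq).map ψ) := by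
    rw [base_toElemZero_map, base_toElemZero_map]
    exact h
  exact ⟨(toBirat F hF hsq).obj W, (toBirat F hF hsq).map φ, (toBirat F hF hsq).map ψ,
    isPreStep_toBirat_map hφ, isPreStep_toBirat_map hψ, key⟩

/-- **Def. 1.3 (i)(c) for `C^birat`**: the functor `(C^birat)^pl-bk_A → D_{A_D}` is an equivalence of
categories — faithful and full in any pre-Frobenioid, and essentially surjective because every object
of `D_{A_D}` is (isomorphic to) the base of a pull-back morphism of `C` into `A` (Def. 1.3 (i)(c) of
`C`), whose image is a pull-back morphism of `C^birat` (Prop. 4.4 (iv)) with the same base.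
[cite: MochizukiFrdI2008, Prop. 4.4 (ii) p.83] -/
theorem i_c (X : Birat F hF hsq) : (pullbackSliceToBase (toElemZero hF hsq) X).IsEquivalence := by
  haveI := pullbackSliceToBase_faithful (toElemZero hF hsq) X
  haveI := pullbackSliceToBase_full (toElemZero hF hsq) X
  refine { faithful := inferInstance, full := inferInstance, essSurj := ⟨fun U => ?_⟩ }
  haveI := hF.i_c X.out
  obtain ⟨P, ⟨e⟩⟩ := Functor.EssSurj.mem_essImage (F := pullbackSliceToBase F X.out)
    (Over.mk (U.hom : U.left ⟶ baseObj F X.out))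
  have hψ : IsPullbackMorphism (toElemZero hF hsq)
      ((toBirat F hF hsq).map P.hom.1 : (toBirat F hF hsq).obj P.left.obj ⟶ X) :=
    isPullbackMorphism_toBirat_map P.hom.2
  let V : Over (⟨X⟩ : PullbackCat (toElemZero hF hsq)) :=
    Over.mk (Y := ⟨(toBirat F hF hsq).obj P.left.obj⟩) ⟨(toBirat F hF hsq).map P.hom.1, hψ⟩
  have hw : e.hom.left ≫ U.hom = Base F P.hom.1 := Over.w e.hom
  refine ⟨V, ⟨Over.isoMk ((Over.forget _).mapIso e) ?_⟩⟩
  change e.hom.left ≫ U.hom = Base (toElemZero hF hsq) ((toBirat F hF hsq).map P.hom.1)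
  rw [base_toElemZero_map]
  exact hw

/-! ### Def. 1.3 (ii) -/

/-- **Def. 1.3 (ii) for `C^birat`, existence**: out of every object and for every `n` there is a
morphism of Frobenius type of degree `n` — the image of one of `C` (a base-isomorphism of `C^birat`,
hence of Frobenius type, `C` being of isotropic type). [cite: MochizukiFrdI2008, Prop. 4.4 (ii) p.83] -/
theorem ii_exists (hiso : IsOfIsotropicType F) (X : Birat F hF hsq) (n : ℕ+) :
    ∃ (Y : Birat F hF hsq) (φ : X ⟶ Y), IsFrobeniusType (toElemZero hF hsq) φ ∧
      degFr (toElemZero hF hsq) φ = n := by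
  obtain ⟨B, φ, hφ, hd⟩ := hF.ii_exists X.out n
  exact ⟨(toBirat F hF hsq).obj B, (toBirat F hF hsq).map φ,
    (isFrobeniusType_iff_isBaseIso hiso _).mpr (isBaseIso_toElemZero_map hφ.2), hd⟩

/-- **Def. 1.3 (ii) for `C^birat`, essential uniqueness**: two morphisms of Frobenius type
`φ : A ⇢ B`, `ψ : A ⇢ B′` of the same degree differ by an isomorphism `B ⥲ B′`. Over a common
denominator `δ`, `φ = δ⁻¹ ∘ φ′`, `ψ = δ⁻¹ ∘ ψ′` with `φ′`, `ψ′` base-isomorphisms of `C` of that degree;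
factor `φ′ = β₁ ∘ γ₁`, `ψ′ = β₂ ∘ γ₂` (Frobenius type, then a pre-step); Def. 1.3 (ii) of `C` gives
`ε` with `ε ∘ γ₁ = γ₂`, and `β₂ ∘ ε ∘ β₁⁻¹` is the required isomorphism (pre-steps of `C^birat` are
invertible, Prop. 4.8 (i)). [cite: MochizukiFrdI2008, Prop. 4.4 (ii) p.83] -/
theorem ii_unique (hiso : IsOfIsotropicType F) ⦃X Y Y' : Birat F hF hsq⦄ (φ : X ⟶ Y) (ψ : X ⟶ Y')
    (hφ : IsFrobeniusType (toElemZero hF hsq) φ) (hψ : IsFrobeniusType (toElemZero hF hsq) ψ)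
    (hd : degFr (toElemZero hF hsq) φ = degFr (toElemZero hF hsq) ψ) :
    ∃ β : Y ≅ Y', φ ≫ β.hom = ψ := by
  obtain ⟨f, rfl⟩ := homMk_surjective φ
  obtain ⟨g, rfl⟩ := homMk_surjective ψ
  -- a common denominator `δ := κ ≫ f.den = κ' ≫ g.den`
  obtain ⟨E, κ, κ', hκ, hκ', hE⟩ := exists_common_refinement hF f.den g.den f.den_mem g.den_mem
  haveI := toBirat_inverts hF hsq (κ ≫ f.den) (hκ.comp hF f.den_mem)
  -- the refined numerators are base-isomorphisms of `C` of equal degree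
  have hn₁ : IsBaseIso F (κ ≫ f.num) := IsBaseIso.comp F hκ.2.2 (isBaseIso_num f hφ.2)
  have hn₂ : IsBaseIso F (κ' ≫ g.num) := IsBaseIso.comp F hκ'.2.2 (isBaseIso_num g hψ.2)
  have hd' : degFr F f.num = degFr F g.num := hd
  -- factor them: Frobenius type, then a pre-step (Prop. 1.7 (ii))
  obtain ⟨X₁, γ₁, β₁, hfac₁, hγ₁, hβ₁⟩ :=
    (isBaseIso_iff_exists_frobeniusType_preStep F hF (κ ≫ f.num)).mp hn₁
  obtain ⟨X₂, γ₂, β₂, hfac₂, hγ₂, hβ₂⟩ :=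
    (isBaseIso_iff_exists_frobeniusType_preStep F hF (κ' ≫ g.num)).mp hn₂
  have hdγ : degFr F γ₁ = degFr F γ₂ := by
    have e₁ := degFr_comp F γ₁ β₁
    have e₂ := degFr_comp F γ₂ β₂
    rw [hfac₁, degFr_comp, show degFr F κ = 1 from hκ.2.1, show degFr F β₁ = 1 from hβ₁.1, one_mul,
      mul_one] at e₁
    rw [hfac₂, degFr_comp, show degFr F κ' = 1 from hκ'.2.1, show degFr F β₂ = 1 from hβ₂.1,
      one_mul, mul_one] at e₂
    rw [← e₁, ← e₂, hd']
  -- Def. 1.3 (ii) of `C`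
  obtain ⟨ε, hε⟩ := hF.ii_unique γ₁ γ₂ hγ₁ hγ₂ hdγ
  -- the pre-steps `βᵢ` are invertible in `C^birat`
  haveI := toBirat_inverts hF hsq β₁ (isCoAngularPreStep_of_isotropic hiso hβ₁)
  haveI := toBirat_inverts hF hsq β₂ (isCoAngularPreStep_of_isotropic hiso hβ₂)
  -- (all computations over the objects `(toBirat).obj _`, cf. the typing note in the header)
  have rhs : (toBirat F hF hsq).map (κ ≫ f.den) ≫
      (homMk g : (toBirat F hF hsq).obj X.out ⟶ (toBirat F hF hsq).obj Y'.out) =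
      (toBirat F hF hsq).map (κ' ≫ g.num) := by
    rw [hE]
    exact toBirat_map_comp_den_comp_homMk g κ'
  have key : (homMk f : (toBirat F hF hsq).obj X.out ⟶ (toBirat F hF hsq).obj Y.out) ≫
      (inv ((toBirat F hF hsq).map β₁) ≫ (toBirat F hF hsq).map ε.hom ≫ (toBirat F hF hsq).map β₂) =
      (homMk g : (toBirat F hF hsq).obj X.out ⟶ (toBirat F hF hsq).obj Y'.out) := by
    rw [← cancel_epi ((toBirat F hF hsq).map (κ ≫ f.den)), ← Category.assoc,
      toBirat_map_comp_den_comp_homMk f κ, rhs, ← hfac₁, ← hfac₂, ← hε, Functor.map_comp,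
      Functor.map_comp, Functor.map_comp, Category.assoc, IsIso.hom_inv_id_assoc, Category.assoc]
  exact ⟨asIso (X := (toBirat F hF hsq).obj Y.out) (Y := (toBirat F hF hsq).obj Y'.out)
    (inv ((toBirat F hF hsq).map β₁) ≫ (toBirat F hF hsq).map ε.hom ≫ (toBirat F hF hsq).map β₂), key⟩

/-! ### Def. 1.3 (iv) -/

/-- Every morphism of `C^birat` is a base-isomorphism followed by the image of a pull-back morphism of
`C` (a linear pull-back morphism of `C^birat`, Prop. 4.4 (iv) and Def. 1.3 (iv)(b) of `C`):
`[(α, φ′)] = (α^birat)⁻¹ ≫ γ^birat ≫ β^birat ≫ a^birat` for the factorisation `φ′ = a ∘ β ∘ γ` of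
Def. 1.3 (iv)(a) in `C`. [cite: MochizukiFrdI2008, Prop. 4.4 (ii) p.83] -/
theorem exists_isBaseIso_comp_isPullbackMorphism ⦃X Y : Birat F hF hsq⦄ (φ : X ⟶ Y) :
    ∃ (Y' : Birat F hF hsq) (u : X ⟶ Y') (α : Y' ⟶ Y), u ≫ α = φ ∧
      IsBaseIso (toElemZero hF hsq) u ∧ IsPullbackMorphism (toElemZero hF hsq) α ∧
      IsLinear (toElemZero hF hsq) α := by
  obtain ⟨f, rfl⟩ := homMk_surjective φ
  obtain ⟨P, Q, γ, β, a, hfac, hγ, hβ, ha⟩ := hF.iv_a_exists f.num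
  haveI := toBirat_inverts hF hsq f.den f.den_mem
  refine ⟨(toBirat F hF hsq).obj Q,
    (inv ((toBirat F hF hsq).map f.den) ≫ (toBirat F hF hsq).map γ ≫ (toBirat F hF hsq).map β :
      (toBirat F hF hsq).obj X.out ⟶ (toBirat F hF hsq).obj Q),
    ((toBirat F hF hsq).map a : (toBirat F hF hsq).obj Q ⟶ (toBirat F hF hsq).obj Y.out), ?_, ?_,
    (isPullbackMorphism_toElemZero_iff _).mpr (isPullbackMorphism_toBirat_map ha),
    (isLinear_toBirat_map_iff a).mpr (hF.iv_b a ha).2⟩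
  · -- (computed over the objects `(toBirat).obj _`)
    have key : (inv ((toBirat F hF hsq).map f.den) ≫ (toBirat F hF hsq).map γ ≫
        (toBirat F hF hsq).map β) ≫ (toBirat F hF hsq).map a =
        (homMk f : (toBirat F hF hsq).obj X.out ⟶ (toBirat F hF hsq).obj Y.out) := by
      rw [homMk_eq_inv_comp f, Category.assoc, Category.assoc, ← Functor.map_comp,
        ← Functor.map_comp, hfac]
    exact key
  · have key : IsBaseIso (toElemZero hF hsq)
        (inv ((toBirat F hF hsq).map f.den) ≫ (toBirat F hF hsq).map γ ≫ (toBirat F hF hsq).map β :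
          (toBirat F hF hsq).obj X.out ⟶ (toBirat F hF hsq).obj Q) :=
      IsBaseIso.comp (toElemZero hF hsq) (isBaseIso_of_isIso (toElemZero hF hsq) _)
        (IsBaseIso.comp (toElemZero hF hsq) (isBaseIso_toElemZero_map hγ.2)
          (isBaseIso_toElemZero_map hβ.2))
    exact key

/-- **Def. 1.3 (iv)(a) for `C^birat`, existence**: `[(α, φ′)]` is `(α⁻¹ ∘ γ ∘ β)^birat` — of
Frobenius type (a base-isomorphism, `C` being of isotropic type) — followed by the identity (a
pre-step) and by `a^birat`, a pull-back morphism (Prop. 4.4 (iv)), where `φ′ = a ∘ β ∘ γ` is the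
factorisation of Def. 1.3 (iv)(a) in `C`. [cite: MochizukiFrdI2008, Prop. 4.4 (ii) p.83] -/
theorem iv_a_exists (hiso : IsOfIsotropicType F) ⦃X Y : Birat F hF hsq⦄ (φ : X ⟶ Y) :
    ∃ (X' Y' : Birat F hF hsq) (γ : X ⟶ X') (β : X' ⟶ Y') (α : Y' ⟶ Y), γ ≫ β ≫ α = φ ∧
      IsFrobeniusType (toElemZero hF hsq) γ ∧ IsPreStep (toElemZero hF hsq) β ∧
      IsPullbackMorphism (toElemZero hF hsq) α := by
  obtain ⟨Y', u, α, h, hu, hα, -⟩ := exists_isBaseIso_comp_isPullbackMorphism φ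
  refine ⟨Y', Y', u, 𝟙 _, α, ?_, (isFrobeniusType_iff_isBaseIso hiso _).mpr hu,
    isPreStep_of_isIso (toElemZero hF hsq) _, hα⟩
  rw [Category.id_comp]
  exact h

/-- **Def. 1.3 (iv)(a) for `C^birat`, uniqueness**: two factorisations `α ∘ β ∘ γ = α′ ∘ β′ ∘ γ′`
(Frobenius type, pre-step, pull-back) are related by isomorphisms `ε`, `δ` as printed. The base map
`Base(β ∘ γ)⁻¹ ≫ Base(β′ ∘ γ′)` lies over `Base(α) ↦ Base(α′)`, so the pull-back property of `α′`
lifts it to `δ : Y → Y′` with `α = α′ ∘ δ` — a pull-back morphism (two-out-of-three) and a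
base-isomorphism, hence an isomorphism — and forces `δ ∘ β ∘ γ = β′ ∘ γ′`; then
`ε := β′⁻¹ ∘ δ ∘ β` (pre-steps of `C^birat` are invertible, Prop. 4.8 (i)).
[cite: MochizukiFrdI2008, Prop. 4.4 (ii) p.83] -/
theorem iv_a_unique (hiso : IsOfIsotropicType F) ⦃A B X Y X' Y' : Birat F hF hsq⦄ (φ : A ⟶ B)
    (γ : A ⟶ X) (β : X ⟶ Y) (α : Y ⟶ B) (γ' : A ⟶ X') (β' : X' ⟶ Y') (α' : Y' ⟶ B)
    (h : γ ≫ β ≫ α = φ) (_hγ : IsFrobeniusType (toElemZero hF hsq) γ)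
    (hβ : IsPreStep (toElemZero hF hsq) β) (hα : IsPullbackMorphism (toElemZero hF hsq) α)
    (h' : γ' ≫ β' ≫ α' = φ) (_hγ' : IsFrobeniusType (toElemZero hF hsq) γ')
    (hβ' : IsPreStep (toElemZero hF hsq) β') (hα' : IsPullbackMorphism (toElemZero hF hsq) α') :
    ∃ (ε : X ≅ X') (δ : Y ≅ Y'), γ ≫ ε.hom = γ' ∧ β ≫ δ.hom = ε.hom ≫ β' ∧ α = δ.hom ≫ α' := by
  haveI : IsIso β := isIso_of_isPreStep hiso β hβ
  haveI : IsIso β' := isIso_of_isPreStep hiso β' hβ'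
  -- `γ ≫ β`, `γ' ≫ β'` are base-isomorphisms
  have hb : IsBaseIso (toElemZero hF hsq) (γ ≫ β) :=
    IsBaseIso.comp _ _hγ.2 (isBaseIso_of_isIso (toElemZero hF hsq) β)
  have hb' : IsBaseIso (toElemZero hF hsq) (γ' ≫ β') :=
    IsBaseIso.comp _ _hγ'.2 (isBaseIso_of_isIso (toElemZero hF hsq) β')
  haveI : IsIso (Base (toElemZero hF hsq) (γ ≫ β)) := hb
  haveI : IsIso (Base (toElemZero hF hsq) (γ' ≫ β')) := hb'
  -- the base map `k : Y_D → Y'_D` over `B_D`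
  let k : baseObj (toElemZero hF hsq) Y ⟶ baseObj (toElemZero hF hsq) Y' :=
    inv (Base (toElemZero hF hsq) (γ ≫ β)) ≫ Base (toElemZero hF hsq) (γ' ≫ β')
  have hφ : Base (toElemZero hF hsq) (γ ≫ β) ≫ Base (toElemZero hF hsq) α =
      Base (toElemZero hF hsq) (γ' ≫ β') ≫ Base (toElemZero hF hsq) α' := by
    rw [← base_comp, ← base_comp, Category.assoc, Category.assoc, h, h']
  have hk : Base (toElemZero hF hsq) α = k ≫ Base (toElemZero hF hsq) α' := by
    rw [Category.assoc, ← hφ, IsIso.inv_hom_id_assoc]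
  -- lift `k` along the pull-back morphism `α'`
  obtain ⟨δ, hδ⟩ := (hα' Y).2 ⟨(α, k), hk⟩
  have hδ₁ : δ ≫ α' = α :=
    congrArg (fun p : PullbackHomData (toElemZero hF hsq) α' Y => p.1.1) hδ
  have hδ₂ : Base (toElemZero hF hsq) δ = k :=
    congrArg (fun p : PullbackHomData (toElemZero hF hsq) α' Y => p.1.2) hδ
  -- `δ` is a pull-back morphism and a base-isomorphism, hence an isomorphism
  have hδpb : IsPullbackMorphism (toElemZero hF hsq) δ :=
    IsPullbackMorphism.of_comp (toElemZero hF hsq) hα' (by rw [hδ₁]; exact hα)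
  have hδbi : IsBaseIso (toElemZero hF hsq) δ := by
    change IsIso (Base (toElemZero hF hsq) δ)
    rw [hδ₂]
    infer_instance
  haveI : IsIso δ := (isPullbackMorphism_and_isBaseIso_iff_isIso (toElemZero hF hsq) δ).mp ⟨hδpb, hδbi⟩
  -- `γ ≫ β ≫ δ = γ' ≫ β'` by the injectivity half of the pull-back property of `α'`
  have hγβδ : (γ ≫ β) ≫ δ = γ' ≫ β' := by
    apply (hα' A).1
    apply Subtype.ext
    apply Prod.ext
    · change ((γ ≫ β) ≫ δ) ≫ α' = (γ' ≫ β') ≫ α'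
      rw [Category.assoc, hδ₁, Category.assoc, h, Category.assoc, h']
    · change Base (toElemZero hF hsq) ((γ ≫ β) ≫ δ) = Base (toElemZero hF hsq) (γ' ≫ β')
      rw [base_comp, hδ₂, IsIso.hom_inv_id_assoc]
  refine ⟨asIso (β ≫ δ ≫ inv β'), asIso δ, ?_, ?_, ?_⟩
  · rw [asIso_hom, ← Category.assoc, ← Category.assoc, hγβδ, Category.assoc, IsIso.hom_inv_id,
      Category.comp_id]
  · rw [asIso_hom, asIso_hom, Category.assoc, Category.assoc, IsIso.inv_hom_id, Category.comp_id]
  · rw [asIso_hom, hδ₁]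

/-- **Def. 1.3 (iv)(b) for `C^birat`**: a pull-back morphism of `C^birat` is LB-invertible (every
morphism of `C^birat` is a co-angular isometry, `C` being of isotropic type and the divisor monoid
being `0_D`) and linear: writing it as `u ≫ a^birat` with `u` a base-isomorphism and `a` a pull-back
morphism of `C` (`exists_isBaseIso_comp_isPullbackMorphism`), `u` is a pull-back morphism
(two-out-of-three; `a^birat` is a pull-back morphism, Prop. 4.4 (iv)) and a base-isomorphism, hence an
isomorphism, and `a` is linear (Def. 1.3 (iv)(b) of `C`). [cite: MochizukiFrdI2008, Prop. 4.4 (ii) p.83] -/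
theorem iv_b (hiso : IsOfIsotropicType F) ⦃X Y : Birat F hF hsq⦄ (φ : X ⟶ Y)
    (hφ : IsPullbackMorphism (toElemZero hF hsq) φ) :
    IsLBInvertible (toElemZero hF hsq) φ ∧ IsLinear (toElemZero hF hsq) φ := by
  refine ⟨⟨isCoAngular hiso φ, isIsometry_toElemZero φ⟩, ?_⟩
  obtain ⟨Y', u, α, h, hu, hα, hlin⟩ := exists_isBaseIso_comp_isPullbackMorphism φ
  have hupb : IsPullbackMorphism (toElemZero hF hsq) u :=
    IsPullbackMorphism.of_comp (toElemZero hF hsq) hα (by rw [h]; exact hφ)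
  haveI : IsIso u :=
    (isPullbackMorphism_and_isBaseIso_iff_isIso (toElemZero hF hsq) u).mp ⟨hupb, hu⟩
  change degFr (toElemZero hF hsq) φ = 1
  rw [← h, degFr_comp, show degFr (toElemZero hF hsq) α = 1 from hlin, mul_one]
  exact isLinear_of_isIso (toElemZero hF hsq) u

end Birat

end PreFrobenioid

end Literature.AlgebraicGeometry.Frobenioids
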